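import Literature.NumberTheory.DiophantineGeometry.CatalanPlusSeries
import Literature.NumberTheory.DiophantineGeometry.CatalanPlusEval
import Literature.NumberTheory.DiophantineGeometry.CatalanMinusArgument
import Literature.NumberTheory.DiophantineGeometry.CatalanMinusPower
import Literature.NumberTheory.DiophantineGeometry.CatalanStickelbergerBridge
import Literature.NumberTheory.DiophantineGeometry.CatalanCasselsBounds
import Literature.NumberTheory.DiophantineGeometry.CatalanWieferich
import HarnessLib

/-!
# The plus argument I: Runge's method for `(x - ζ_p)^θ = α^q` [Schoof2009, Theorem 12.4]

[Schoof2009, Theorem 12.4] (Mihăilescu): *let `p, q ≥ 7` be distinct primes and `x, y` non-zero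
integers with `x^p - y^q = 1`; then the `𝔽_q[G⁺]`-annihilator of `(x - ζ_p)^{1+ι}` in the
obstruction group `H` is trivial.* We prove it in the following concrete form
(`Catalan.Plus.dvd_of_prod_pow_eq_pow`), to which the module-theoretic statement reduces by
[Schoof2009, Lemma 12.3]: if `n : G → ℕ` (`G = (ℤ/pℤ)ˣ`, `σ_c ζ_p = ζ_p^c`) satisfies `n_{-c} = n_c`,
`∑ n_c = mq` with `2m ≤ p - 1`, and `∏_c (x - ζ_p^c)^{n_c} = α^q` for some `α ∈ ℚ(ζ_p)`, then
`q ∣ n_c` for all `c` (here only `q ≥ 7`, `p` odd, `p ≠ q` are needed).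

The proof is [Schoof2009, pp. 80–82]: `α` is real under every embedding (`ια = α` because
`ℚ(ζ_p)` has no `q`-th roots of unity), hence `φ(α) = x^m F^φ(1/x)` for the power series
`F(T) = ∏_c (1 - ζ_p^c T)^{n_c/q}` (`CatalanPlusSeries`, `CatalanPlusEval`); with
`D = q^{m + ord_q(m!)}` the algebraic integer `D(α - x^m F_m(1/x))` has all its conjugates of
absolute value `< 1` (tail estimate and `|x| ≥ q^{p-1} + q`, Cassels), hence vanishes; reading
`Dα = ∑_k D e_k x^{m-k}` modulo `q` gives `q ∣ c_m ≡ (-∑ n_c ζ_p^c)^m`, so `q ∣ ∑ n_c ζ_p^c`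
(`ℤ[ζ_p]/(q)` is reduced) and `q ∣ n_c` (integral basis).

Third file of the formalisation of [Schoof2009, Chapter 12]. Everything is proved; no definitions.

## References

* R. Schoof, *Catalan's Conjecture*, Universitext, Springer 2009 [Schoof2009], Propositions 12.1,
  12.2, Lemma 12.3, Theorem 12.4 (book pp. 77–82) — held,
  `lit read book:schoof2009-catalan-s-conjecture` (PDF pp. 157–162).
* P. Mihăilescu, *Primary cyclotomic units and a proof of Catalan's conjecture*, J. reine angew.
  Math. **572** (2004), 167–195 [Mihailescu2004].
-/

namespace Literature.NumberTheory.DiophantineGeometry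

namespace Catalan.Plus

open Finset PowerSeries NumberField
open Literature.NumberTheory.NumberFields.Stickelberger Catalan.Minus


/-! ### The numerical inequality of [Schoof2009, p. 81] -/

/-- `4^m ≤ 7^{m - ⌊m/6⌋}` (`4^6 = 4096 ≤ 16807 = 7^5`). [cite: Schoof2009, Theorem 12.4 (proof, p. 81)] -/
theorem four_pow_le_seven_pow (m : ℕ) : 4 ^ m ≤ 7 ^ (m - m / 6) := by
  have h1 : m = 6 * (m / 6) + m % 6 := (Nat.div_add_mod m 6).symm
  have h2 : m - m / 6 = 5 * (m / 6) + m % 6 := by omega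
  rw [h2]
  conv_lhs => rw [h1]
  rw [pow_add, pow_add, pow_mul, pow_mul]
  exact Nat.mul_le_mul (Nat.pow_le_pow_left (by norm_num) _) (Nat.pow_le_pow_left (by norm_num) _)

/-- `C(2m, m+1) + 1 ≤ 4^m` for `m ≥ 1`. [folklore] -/
theorem choose_succ_le_four_pow {m : ℕ} (hm : 1 ≤ m) : (2 * m).choose (m + 1) + 1 ≤ 4 ^ m := by
  have h1 : ∑ k ∈ ({0, m + 1} : Finset ℕ), (2 * m).choose k ≤
      ∑ k ∈ range (2 * m + 1), (2 * m).choose k :=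
    sum_le_sum_of_subset_of_nonneg (fun k hk => by
      simp only [mem_insert, mem_singleton] at hk
      rcases hk with rfl | rfl
      · simp
      · simp only [mem_range]; omega) fun _ _ _ => Nat.zero_le _
  rw [sum_pair (by omega : (0 : ℕ) ≠ m + 1), Nat.sum_range_choose, Nat.choose_zero_right,
    pow_mul, show (2 : ℕ) ^ 2 = 4 by norm_num] at h1
  omega

/-- **The `q`-adic size of `D = q^{m + ord_q(m!)}` against `C(2m, m+1)`**: for `q ≥ 7`, `m ≥ 1`
and `(q-1)·v ≤ m` (Legendre: `v = ord_q(m!)`), `q^{m+v} (C(2m,m+1) + 1) ≤ q^{2m}`.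
[cite: Schoof2009, Theorem 12.4 (proof, p. 81)] -/
theorem pow_mul_choose_succ_le {q m v : ℕ} (hq7 : 7 ≤ q) (hm : 1 ≤ m) (hv : (q - 1) * v ≤ m) :
    q ^ (m + v) * ((2 * m).choose (m + 1) + 1) ≤ q ^ (2 * m) := by
  have hv6 : v ≤ m / 6 := by
    rw [Nat.le_div_iff_mul_le (by norm_num)]
    calc v * 6 = 6 * v := mul_comm _ _
      _ ≤ (q - 1) * v := Nat.mul_le_mul_right _ (by omega)
      _ ≤ m := hv
  have hvm : v ≤ m := hv6.trans (Nat.div_le_self _ _)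
  calc q ^ (m + v) * ((2 * m).choose (m + 1) + 1)
      ≤ q ^ (m + v) * 4 ^ m := Nat.mul_le_mul_left _ (choose_succ_le_four_pow hm)
    _ ≤ q ^ (m + v) * 7 ^ (m - m / 6) := Nat.mul_le_mul_left _ (four_pow_le_seven_pow m)
    _ ≤ q ^ (m + v) * q ^ (m - m / 6) := Nat.mul_le_mul_left _ (Nat.pow_le_pow_left hq7 _)
    _ ≤ q ^ (m + v) * q ^ (m - v) :=
        Nat.mul_le_mul_left _ (Nat.pow_le_pow_right (by omega) (by omega))
    _ = q ^ (2 * m) := by rw [← pow_add]; congr 1; omega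

/-- `2m + 1 ≤ 4^m`. [folklore] -/
theorem two_mul_succ_le_four_pow (m : ℕ) : 2 * m + 1 ≤ 4 ^ m := by
  induction m with
  | zero => norm_num
  | succ k ih => rw [pow_succ]; omega

/-- **The final inequality of [Schoof2009, Theorem 12.4]** in the present bookkeeping: for
`q ≥ 7`, `m ≥ 1`, `(q-1)v ≤ m` and `X ≥ q^{2m} + 7` (`X = |x| ≥ q^{p-1} + q`, `2m ≤ p - 1`),
`q^{m+v} C(2m, m+1) X^{2m} < (X - 1)^{2m+1}`, i.e. `|φ(Dz)| < 1`.
[cite: Schoof2009, Theorem 12.4 (proof, p. 81)] -/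
theorem runge_bound_lt {q m v : ℕ} (hq7 : 7 ≤ q) (hm : 1 ≤ m) (hv : (q - 1) * v ≤ m) {X : ℝ}
    (hX : (q : ℝ) ^ (2 * m) + 7 ≤ X) :
    (q : ℝ) ^ (m + v) * ((2 * m).choose (m + 1)) * X ^ (2 * m) < (X - 1) ^ (2 * m + 1) := by
  have hN := pow_mul_choose_succ_le hq7 hm hv
  -- `D' + 2m + 1 < X`
  have h2m : 2 * m + 1 ≤ q ^ (m + v) := by
    calc 2 * m + 1 ≤ 4 ^ m := two_mul_succ_le_four_pow m
      _ ≤ 7 ^ m := Nat.pow_le_pow_left (by norm_num) _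
      _ ≤ q ^ m := Nat.pow_le_pow_left hq7 _
      _ ≤ q ^ (m + v) := Nat.pow_le_pow_right (by omega) (by omega)
  have hD : (q : ℝ) ^ (m + v) * ((2 * m).choose (m + 1)) + (2 * m + 1) < X := by
    have h1 : q ^ (m + v) * (2 * m).choose (m + 1) + (2 * m + 1) ≤ q ^ (2 * m) := by
      have := Nat.mul_le_mul_left (q ^ (m + v)) (le_refl ((2 * m).choose (m + 1) + 1))
      rw [mul_add, mul_one] at hN
      omega
    have h2 : ((q ^ (m + v) * (2 * m).choose (m + 1) + (2 * m + 1) : ℕ) : ℝ) ≤ (q : ℝ) ^ (2 * m) := by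
      exact_mod_cast h1
    push_cast at h2
    linarith
  have hX1 : 1 < X := by
    have : (0 : ℝ) < (q : ℝ) ^ (2 * m) := by positivity
    linarith
  -- Bernoulli: `(X-1)^{2m+1} ≥ X^{2m} (X - 2m - 1)`
  have hB : X ^ (2 * m) * (X - (2 * m + 1)) ≤ (X - 1) ^ (2 * m + 1) := by
    have h1 := one_add_mul_le_pow (show (-2 : ℝ) ≤ -1 / X by
      rw [neg_div, neg_le_neg_iff]
      exact ((div_le_one (by linarith)).mpr hX1.le).trans (by norm_num)) (2 * m + 1)
    have h2 : (X - 1) ^ (2 * m + 1) = X ^ (2 * m + 1) * (1 + -1 / X) ^ (2 * m + 1) := by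
      rw [← mul_pow]; congr 1; field_simp; ring
    rw [h2, pow_succ]
    have h3 : X ^ (2 * m) * (X - (2 * m + 1)) = X ^ (2 * m) * X * (1 + (2 * m + 1 : ℕ) * (-1 / X)) := by
      field_simp
      push_cast
      ring
    rw [h3]
    exact mul_le_mul_of_nonneg_left h1 (by positivity)
  calc (q : ℝ) ^ (m + v) * ((2 * m).choose (m + 1)) * X ^ (2 * m)
      = X ^ (2 * m) * ((q : ℝ) ^ (m + v) * ((2 * m).choose (m + 1))) := by ring
    _ < X ^ (2 * m) * (X - (2 * m + 1)) := by
        apply mul_lt_mul_of_pos_left _ (by positivity)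
        linarith
    _ ≤ (X - 1) ^ (2 * m + 1) := hB

section Cyclotomic

variable {p : ℕ} [hp : Fact p.Prime] {K : Type*} [Field K] [NumberField K]
  [hK : IsCyclotomicExtension {p} ℚ K] {ζ : K}

/-! ### `ℚ(ζ_p)` has no `q`-th roots of unity; `α` is real -/

/-- `ℚ(ζ_p)` (`p` odd) contains no non-trivial `q`-th root of unity for a prime `q ∤ 2p`.
[cite: Schoof2009, Theorem 12.4 (proof), Exercise 7.3] -/
theorem eq_one_of_pow_eq_one (hpo : Odd p) {q : ℕ} (hq : q.Prime) (hq2 : q ≠ 2) (hpq : p ≠ q)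
    {ξ : K} (hξ : ξ ^ q = 1) : ξ = 1 := by
  have hint : IsIntegral ℤ ξ := by
    refine IsIntegral.of_pow hq.pos ?_
    rw [hξ]
    exact isIntegral_one
  set ξO : 𝓞 K := ⟨ξ, hint⟩ with hξOdef
  have hξO : ξO ^ q = 1 := by
    apply RingOfIntegers.ext
    simp [hξOdef, hξ]
  set u : (𝓞 K)ˣ := Units.ofPowEqOne ξO q hξO hq.ne_zero with hudef
  have huq : u ^ q = 1 := Units.pow_ofPowEqOne _ _
  have hu_tors : u ∈ NumberField.Units.torsion K :=
    (CommGroup.mem_torsion u).mpr (isOfFinOrder_iff_pow_eq_one.mpr ⟨q, hq.pos, huq⟩)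
  have h2p := pow_two_mul_eq_one_of_mem_torsion hpo hu_tors
  have huq' : (u : 𝓞 K) ^ q = 1 := by rw [← Units.val_pow_eq_pow_val, huq, Units.val_one]
  have hcop : Nat.gcd q (2 * p) = 1 := by
    refine Nat.Coprime.mul_right ?_ ?_
    · exact (Nat.coprime_primes hq Nat.prime_two).mpr hq2
    · exact (Nat.coprime_primes hq hp.out).mpr (Ne.symm hpq)
  have h1 : (u : 𝓞 K) ^ Nat.gcd q (2 * p) = 1 := pow_gcd_eq_one.mpr ⟨huq', h2p⟩
  rw [hcop, pow_one] at h1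
  have h2 : ((u : 𝓞 K) : K) = ξ := rfl
  rw [← h2, h1]
  rfl

/-- **`α` is real** ([Schoof2009, Prop. 12.2 (ii) with Lemma 12.3]): if `n_{-c} = n_c` and
`∏_c (x - ζ^c)^{n_c} = α^q` then `ια = α`, so every complex embedding maps `α` into `ℝ`.
[cite: Schoof2009, Proposition 12.2 (ii)] -/
theorem conj_embedding_eq_self (hζ : IsPrimitiveRoot ζ p) (hpo : Odd p) {q : ℕ} (hq : q.Prime)
    (hq2 : q ≠ 2) (hpq : p ≠ q) (n : (ZMod p)ˣ → ℕ) (hn : ∀ c, n (-c) = n c) {x : ℤ} {α : K}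
    (hα : ∏ c : (ZMod p)ˣ, ((x : K) - ζ ^ (c : ZMod p).val) ^ n c = α ^ q) (ψ : K →+* ℂ) :
    starRingEnd ℂ (ψ α) = ψ α := by
  have hp2 : p ≠ 2 := fun h2 => by
    rw [h2] at hpo
    exact (Nat.not_even_iff_odd.mpr hpo) even_two
  set A := ∏ c : (ZMod p)ˣ, ((x : K) - ζ ^ (c : ZMod p).val) ^ n c with hAdef
  have hA : gal p K (-1) A = A := by
    rw [hAdef, map_prod]
    simp_rw [map_pow, map_sub, map_intCast, gal_apply_zeta_pow hζ]
    refine Fintype.prod_equiv (Equiv.neg _) _ _ fun c => ?_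
    simp only [Equiv.neg_apply, neg_one_mul, hn]
  have hA0 : A ≠ 0 :=
    prod_ne_zero_iff.mpr fun c _ => pow_ne_zero _ (intCast_sub_zeta_pow_ne_zero hζ hp2 x c)
  have hα0 : α ≠ 0 := by
    rintro rfl
    rw [zero_pow hq.ne_zero] at hα
    exact hA0 hα
  have h1 : (gal p K (-1) α / α) ^ q = 1 := by
    rw [div_pow, ← map_pow, ← hα, hA, div_self hA0]
  have h2 := eq_one_of_pow_eq_one hpo hq hq2 hpq h1
  rw [div_eq_one_iff_eq hα0] at h2
  rw [← embedding_comp_gal_neg_one hζ ψ α, h2]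

/-! ### An algebraic integer all of whose conjugates are `< 1` vanishes -/

omit hK in
/-- If `|ψ(W)| ≤ B < 1` for all embeddings `ψ` then the algebraic integer `W` is `0` (its norm is
an integer of absolute value `< 1`). [cite: Schoof2009, Theorem 12.4 (proof)] -/
theorem eq_zero_of_forall_norm_embedding_le {W : 𝓞 K} {B : ℝ} (hB0 : 0 ≤ B) (hB : B < 1)
    (h : ∀ ψ : K →+* ℂ, ‖ψ W‖ ≤ B) : W = 0 := by
  have h1 := abs_norm_le_pow_of_forall_embedding h
  have hn : 0 < Module.finrank ℚ K := Module.finrank_pos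
  have h2 : |((Algebra.norm ℚ (W : K) : ℚ) : ℝ)| < 1 := h1.trans_lt (pow_lt_one₀ hB0 hB hn.ne')
  rw [← Algebra.coe_norm_int] at h2
  have h3 : Algebra.norm ℤ W = 0 := by
    have h4 : |Algebra.norm ℤ W| < 1 := by exact_mod_cast h2
    exact Int.abs_lt_one_iff.mp h4
  exact Algebra.norm_eq_zero_iff.mp h3

/-! ### `q ∣ ∑ n_c ζ^c ⟹ q ∣ n_c` (integral basis `1, ζ, …, ζ^{p-2}`) -/

/-- The `0`-th coordinate, with respect to the integral power basis `1, ζ, …, ζ^{p-2}` of `ℤ[ζ_p]`,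
of `∑_c n_c ζ^c` (`c` over `(ℤ/pℤ)ˣ`) is `-n_{-1}` (as `ζ^{p-1} = -1 - ζ - ⋯ - ζ^{p-2}`); hence
`q ∣ ∑_c n_c ζ^c` in `ℤ[ζ_p]` implies `q ∣ n_{-1}`. [cite: Schoof2009, Theorem 12.4 (proof, last step)] -/
theorem dvd_apply_neg_one_of_dvd_sum (hζ : IsPrimitiveRoot ζ p) (n : (ZMod p)ˣ → ℤ) {q : ℤ}
    (h : (q : 𝓞 K) ∣ ∑ c, (n c : 𝓞 K) * hζ.toInteger ^ (c : ZMod p).val) : q ∣ n (-1) := by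
  classical
  haveI : NeZero p := ⟨hp.out.ne_zero⟩
  set z : 𝓞 K := hζ.toInteger with hzdef
  set pb := hζ.integralPowerBasis with hpbdef
  have hdim : pb.dim = p - 1 := by
    rw [hpbdef, IsPrimitiveRoot.integralPowerBasis_dim, Nat.totient_prime hp.out]
  have hgen : pb.gen = z := by rw [hpbdef, IsPrimitiveRoot.integralPowerBasis_gen]
  have hd0 : 0 < pb.dim := by rw [hdim]; have := hp.out.two_le; omega
  set i₀ : Fin pb.dim := ⟨0, hd0⟩
  set coord : 𝓞 K →ₗ[ℤ] ℤ :=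
    (Finsupp.lapply i₀) ∘ₗ (pb.basis.repr : 𝓞 K →ₗ[ℤ] (Fin pb.dim →₀ ℤ)) with hcoord
  have hcoord_apply : ∀ w, coord w = pb.basis.repr w i₀ := fun w => rfl
  -- values of the coordinate functional on powers of `z`
  have hpow : ∀ j (hj : j < pb.dim), coord (z ^ j) = if j = 0 then 1 else 0 := by
    intro j hj
    have : z ^ j = pb.basis ⟨j, hj⟩ := by rw [PowerBasis.coe_basis, hgen]
    rw [this, hcoord_apply, Module.Basis.repr_self, Finsupp.single_apply]
    simp only [Fin.ext_iff, i₀]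
  have hlast : coord (z ^ (p - 1)) = -1 := by
    have hgeom : ∑ j ∈ range p, z ^ j = 0 :=
      hζ.toInteger_isPrimitiveRoot.geom_sum_eq_zero hp.out.one_lt
    have hsplit : z ^ (p - 1) = -∑ j ∈ range (p - 1), z ^ j := by
      have : ∑ j ∈ range p, z ^ j = ∑ j ∈ range (p - 1), z ^ j + z ^ (p - 1) := by
        rw [← sum_range_succ, Nat.sub_add_cancel hp.out.one_lt.le]
      rw [this] at hgeom
      linear_combination hgeom
    rw [hsplit, map_neg, map_sum]
    rw [sum_eq_single_of_mem 0 (mem_range.mpr (by have := hp.out.two_le; omega))]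
    · rw [hpow 0 hd0, if_pos rfl]
    · intro j hj hj0
      rw [hpow j (by rw [hdim]; exact mem_range.mp hj), if_neg hj0]
  -- the coordinate of `w = ∑ n_c z^c` is `-n_{-1}`
  have hval : ∀ c : (ZMod p)ˣ, coord (z ^ (c : ZMod p).val) = if c = -1 then -1 else 0 := by
    intro c
    by_cases hc : c = -1
    · rw [if_pos hc, hc, val_neg_units, show ((1 : (ZMod p)ˣ) : ZMod p).val = 1 by
        rw [Units.val_one, ZMod.val_one], hlast]
    · rw [if_neg hc]
      have h1 : (c : ZMod p).val < pb.dim := by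
        rw [hdim]
        have h2 : (c : ZMod p).val < p := ZMod.val_lt _
        have h3 : (c : ZMod p).val ≠ p - 1 := by
          intro h4
          apply hc
          apply Units.ext
          rw [Units.val_neg, Units.val_one]
          apply ZMod.val_injective
          rw [h4, ZMod.neg_val, ZMod.val_one, if_neg one_ne_zero]
        omega
      rw [hpow _ h1, if_neg]
      intro h0
      exact c.ne_zero ((ZMod.val_eq_zero _).mp h0)
  have hw : coord (∑ c, (n c : 𝓞 K) * z ^ (c : ZMod p).val) = -n (-1) := by
    rw [map_sum]
    simp_rw [← zsmul_eq_mul, map_zsmul, hval, smul_eq_mul, mul_ite, mul_neg, mul_one, mul_zero]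
    rw [Fintype.sum_ite_eq']
  obtain ⟨u, hu⟩ := h
  have h2 : coord (∑ c, (n c : 𝓞 K) * z ^ (c : ZMod p).val) = q * coord u := by
    rw [hu, ← zsmul_eq_mul, map_zsmul, smul_eq_mul]
  rw [hw] at h2
  exact ⟨-coord u, by linear_combination -h2⟩

/-- **`q ∣ ∑_c n_c ζ^c` in `ℤ[ζ_p]` implies `q ∣ n_c` for every `c`** (apply `σ_a` and the
previous lemma). [cite: Schoof2009, Theorem 12.4 (proof, last step)] -/
theorem dvd_of_dvd_sum (hζ : IsPrimitiveRoot ζ p) (n : (ZMod p)ˣ → ℤ) {q : ℤ}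
    (h : (q : 𝓞 K) ∣ ∑ c, (n c : 𝓞 K) * hζ.toInteger ^ (c : ZMod p).val) (c₀ : (ZMod p)ˣ) :
    q ∣ n c₀ := by
  classical
  set a : (ZMod p)ˣ := -c₀⁻¹ with ha
  -- apply `σ_a`
  have h1 : (q : 𝓞 K) ∣ ∑ c, (n c : 𝓞 K) * hζ.toInteger ^ ((a * c : (ZMod p)ˣ) : ZMod p).val := by
    have h2 : gal p K a • ((q : ℤ) : 𝓞 K) ∣
        gal p K a • ∑ c, (n c : 𝓞 K) * hζ.toInteger ^ (c : ZMod p).val :=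
      map_dvd (MulSemiringAction.toRingHom _ (𝓞 K) (gal p K a)) h
    have h3 : ∀ c, gal p K a • ((n c : 𝓞 K) * hζ.toInteger ^ (c : ZMod p).val) =
        (n c : 𝓞 K) * hζ.toInteger ^ ((a * c : (ZMod p)ˣ) : ZMod p).val := by
      intro c
      rw [smul_mul', gal_smul_intCast, smul_pow', gal_smul_toInteger hζ, ← pow_mul]
      congr 1
      exact toInteger_pow_eq_pow hζ (by rw [Units.val_mul, ZMod.val_mul, Nat.mod_mod])
    rwa [gal_smul_intCast, smul_sum, Finset.sum_congr rfl (fun c _ => h3 c)] at h2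
  -- reindex `c ↦ a⁻¹ c`
  have h3 : ∑ c, (n c : 𝓞 K) * hζ.toInteger ^ ((a * c : (ZMod p)ˣ) : ZMod p).val =
      ∑ c, (n (a⁻¹ * c) : 𝓞 K) * hζ.toInteger ^ (c : ZMod p).val := by
    refine Fintype.sum_equiv (Equiv.mulLeft a) _ _ fun c => ?_
    simp only [Equiv.coe_mulLeft, inv_mul_cancel_left]
  rw [h3] at h1
  have h4 := dvd_apply_neg_one_of_dvd_sum hζ (fun c => n (a⁻¹ * c)) h1
  have h5 : a⁻¹ * -1 = c₀ := by rw [ha, inv_neg, inv_inv, neg_mul_neg, mul_one]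
  simpa only [h5] using h4

/-! ### The power series `F(T) = ∏_c (1 - ζ^c T)^{n_c/q}` under a complex embedding -/

omit hK in
/-- A complex embedding `ψ` maps `∏ (1 + w_i T)^{n_i/q} ∈ K⟦T⟧` coefficientwise to the same product
over `ℂ`. [folklore] -/
theorem map_prod_rescale_binomialSeries {ι : Type*} (s : Finset ι) (ψ : K →+* ℂ) (w : ι → 𝓞 K)
    (n : ι → ℕ) (q : ℕ) :
    PowerSeries.map ψ (∏ i ∈ s, rescale (algebraMap (𝓞 K) K (w i))
        (PowerSeries.binomialSeries K ((n i : K) / q))) =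
      ∏ i ∈ s, rescale (ψ (algebraMap (𝓞 K) K (w i)))
        (PowerSeries.binomialSeries ℂ ((n i : ℂ) / q)) := by
  rw [map_prod]
  refine prod_congr rfl fun i _ => ?_
  ext k
  rw [coeff_map, coeff_rescale_binomialSeries, coeff_rescale_binomialSeries, map_mul, map_pow,
    ring_choose_eq_prod_div_factorial, ring_choose_eq_prod_div_factorial, map_div₀, map_prod,
    map_natCast]
  congr 2
  refine prod_congr rfl fun j _ => ?_
  rw [map_sub, map_div₀, map_natCast, map_natCast, map_natCast]

/-! ### [Schoof2009, Theorem 12.4] -/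

/-- **[Schoof2009, Theorem 12.4]** (Mihăilescu; concrete form). Let `p` be an odd prime, `q ≥ 7` a
prime different from `p`, and `x, y` non-zero integers with `x ^ p - y ^ q = 1`. Let `n : G → ℕ`
(`G = (ℤ/pℤ)ˣ`) with `n_{-c} = n_c` for all `c`, `∑_c n_c = mq` with `2m ≤ p - 1`, and suppose
`∏_c (x - ζ^c)^{n_c} = α^q` for some `α ∈ K = ℚ(ζ_p)`. Then `q ∣ n_c` for every `c`. (For a lift
`θ = ∑ n_σ σ` of `(1+ι)ψ` as in [Schoof2009, Lemma 12.3] this says `ψ = 0` in `𝔽_q[G⁺]`: the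
`𝔽_q[G⁺]`-annihilator of `(x - ζ_p)^{1+ι}` in `H` is trivial.)
[cite: Schoof2009, Theorem 12.4] -/
theorem dvd_of_prod_pow_eq_pow (hζ : IsPrimitiveRoot ζ p) (hpo : Odd p) {q : ℕ} (hq : q.Prime)
    (hq7 : 7 ≤ q) (hpq : p ≠ q) {x y : ℤ} (hx : x ≠ 0) (hy : y ≠ 0) (h : x ^ p - y ^ q = 1)
    (n : (ZMod p)ˣ → ℕ) (hn : ∀ c, n (-c) = n c) {m : ℕ} (hm : ∑ c, n c = m * q)
    (hmp : 2 * m ≤ p - 1) {α : K}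
    (hα : ∏ c : (ZMod p)ˣ, ((x : K) - ζ ^ (c : ZMod p).val) ^ n c = α ^ q) (c₀ : (ZMod p)ˣ) :
    q ∣ n c₀ := by
  classical
  -- ### the case `m = 0`
  rcases Nat.eq_zero_or_pos m with rfl | hm1
  · rw [zero_mul, Finset.sum_eq_zero_iff] at hm
    rw [hm c₀ (mem_univ _)]
    exact dvd_zero _
  -- ### basic facts
  haveI := Fact.mk hq
  have hq2 : q ≠ 2 := by omega
  have hqo : Odd q := hq.odd_of_ne_two hq2
  set z : 𝓞 K := hζ.toInteger with hzdef
  have hzK : (z : K) = ζ := rfl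
  -- ### `α` is an algebraic integer
  have hαint : IsIntegral ℤ α := by
    refine IsIntegral.of_pow hq.pos ?_
    rw [← hα]
    have hxint : IsIntegral ℤ (x : K) := by
      have := isIntegral_algebraMap (R := ℤ) (A := K) (x := x)
      rwa [eq_intCast] at this
    exact IsIntegral.prod _ fun c _ =>
      (hxint.sub ((hζ.isIntegral hp.out.pos).pow _)).pow _
  set αO : 𝓞 K := ⟨α, hαint⟩ with hαOdef
  have hαO : algebraMap (𝓞 K) K αO = α := rfl
  -- ### Cassels: `X = |x| ≥ q^{p-1} + q ≥ q^{2m} + 7`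
  have hXge := cassels_abs_x_ge hp.out hq hpo hqo hx hy h
  set Xr : ℝ := |(x : ℝ)| with hXrdef
  have hXq : (q : ℝ) ^ (2 * m) + 7 ≤ Xr := by
    have h1 : (q : ℤ) ^ (2 * m) ≤ (q : ℤ) ^ (p - 1) := pow_le_pow_right₀ (by omega) hmp
    have h2 : ((q : ℤ) ^ (2 * m) + 7 : ℤ) ≤ |x| := by omega
    have h3 : (((q : ℤ) ^ (2 * m) + 7 : ℤ) : ℝ) ≤ ((|x| : ℤ) : ℝ) := by exact_mod_cast h2
    rw [Int.cast_abs] at h3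
    push_cast at h3
    exact h3
  have hX1 : 1 < Xr := by
    have : (0 : ℝ) < (q : ℝ) ^ (2 * m) := by positivity
    linarith
  have hx0 : (x : ℝ) ≠ 0 := by exact_mod_cast hx
  have hXr0 : 0 < Xr := by linarith
  -- ### the series `S = ∏_c (1 - ζ^c T)^{n_c/q}` and its coefficients ([Schoof2009, Prop. 12.1])
  set w : (ZMod p)ˣ → 𝓞 K := fun c => -z ^ (c : ZMod p).val with hwdef
  set S : K⟦X⟧ := ∏ c, rescale (algebraMap (𝓞 K) K (w c))
    (PowerSeries.binomialSeries K ((n c : K) / q)) with hSdef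
  have hInt := intOutside_prod_rescale_binomialSeries (K := K) (q := q)
    (univ : Finset (ZMod p)ˣ) w n
  choose yk hyk using hInt
  have hCong := expCong_prod_rescale_binomialSeries (K := K) hq.ne_zero
    (univ : Finset (ZMod p)ˣ) w n
  choose ck hck hckq using hCong
  -- ### `D = q^{m+v}` and the algebraic integer `W = D(α - ∑_{k ≤ m} e_k x^{m-k})`
  set v := padicValNat q (Nat.factorial m) with hvdef
  have hvk : ∀ k ≤ m, padicValNat q (Nat.factorial k) ≤ v := by
    intro k hk
    exact (padicValNat_dvd_iff_le (Nat.factorial_ne_zero m)).mp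
      (pow_padicValNat_dvd.trans (Nat.factorial_dvd_factorial hk))
  have hv' : (q - 1) * v ≤ m := by
    rw [hvdef, sub_one_mul_padicValNat_factorial]
    exact Nat.sub_le _ _
  set W : 𝓞 K := (q : 𝓞 K) ^ (m + v) * αO -
    ∑ k ∈ range (m + 1), (q : 𝓞 K) ^ ((m - k) + (v - padicValNat q (Nat.factorial k))) * yk k *
      (x : 𝓞 K) ^ (m - k) with hWdef
  have hWK : algebraMap (𝓞 K) K W = (q : K) ^ (m + v) *
      (α - ∑ k ∈ range (m + 1), coeff k S * (x : K) ^ (m - k)) := by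
    rw [hWdef, map_sub, map_mul, map_pow, map_natCast, map_sum, hαO, mul_sub, mul_sum]
    congr 1
    refine sum_congr rfl fun k hk => ?_
    have hkm : k ≤ m := Nat.lt_succ_iff.mp (mem_range.mp hk)
    rw [map_mul, map_mul, map_pow, map_pow, map_natCast, map_intCast, hyk k]
    have he : (m - k) + (v - padicValNat q (Nat.factorial k)) + (k + padicValNat q (Nat.factorial k)) =
        m + v := by
      have := hvk k hkm
      omega
    rw [← he]
    ring
  -- ### the bound `|ψ(W)| ≤ B < 1` for every complex embedding `ψ`
  set B : ℝ := (q : ℝ) ^ (m + v) * ((2 * m).choose (m + 1)) * Xr ^ (2 * m) /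
    (Xr - 1) ^ (2 * m + 1) with hBdef
  have hXr1 : 0 < Xr - 1 := by linarith
  have hB0 : 0 ≤ B := by positivity
  have hB1 : B < 1 := by
    rw [hBdef, div_lt_one (pow_pos hXr1 _)]
    exact runge_bound_lt hq7 hm1 hv' hXq
  have hbound : ∀ ψ : K →+* ℂ, ‖ψ W‖ ≤ B := by
    intro ψ
    -- the complex data: `zc = 1/x`, `a_c = -ψ(ζ^c)`, `r_c = n_c/q`
    set zc : ℂ := (x : ℂ)⁻¹ with hzcdef
    have hxz : (x : ℂ) * zc = 1 := by
      rw [hzcdef]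
      exact mul_inv_cancel₀ (by exact_mod_cast hx)
    have hzc_norm : ‖zc‖ = Xr⁻¹ := by rw [hzcdef, norm_inv, Complex.norm_intCast]
    have hzc1 : ‖zc‖ < 1 := by
      rw [hzc_norm]
      exact inv_lt_one_of_one_lt₀ hX1
    set a : (ZMod p)ˣ → ℂ := fun c => ψ (algebraMap (𝓞 K) K (w c)) with hadef
    have ha_eq : ∀ c, a c = -ψ (ζ ^ (c : ZMod p).val) := by
      intro c
      simp only [hadef, hwdef, map_neg, map_pow]
      rw [← hzK]
    have hζnorm : ∀ j : ℕ, ‖ψ (ζ ^ j)‖ = 1 := fun j => by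
      rw [map_pow, norm_pow, (hζ.map_of_injective ψ.injective).norm'_eq_one hp.out.ne_zero, one_pow]
    have ha1 : ∀ c ∈ (univ : Finset (ZMod p)ˣ), ‖a c‖ ≤ 1 := fun c _ => by
      rw [ha_eq, norm_neg, hζnorm]
    set r : (ZMod p)ˣ → ℝ := fun c => (n c : ℝ) / q with hrdef
    have hr0 : ∀ c ∈ (univ : Finset (ZMod p)ˣ), 0 ≤ r c := fun c _ => by positivity
    have hrsum : ∑ c, r c = m := by
      simp only [hrdef]
      rw [← sum_div, ← Nat.cast_sum, hm]
      push_cast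
      field_simp
    have hcast : ∀ c, ((r c : ℝ) : ℂ) = (n c : ℂ) / q := by
      intro c
      simp only [hrdef, Complex.ofReal_div, Complex.ofReal_natCast]
    -- `ψ` maps `S` to the complex series of `CatalanPlusEval`
    have hmapS : PowerSeries.map ψ S =
        ∏ c, rescale (a c) (PowerSeries.binomialSeries ℂ ((r c : ℝ) : ℂ)) := by
      rw [hSdef, map_prod_rescale_binomialSeries]
      refine prod_congr rfl fun c _ => ?_
      rw [hcast]
    -- the tail estimate [Schoof2009, Prop. 12.1 (iii)]
    have htail := norm_sub_sum_le univ a r ha1 hr0 hm1 hrsum hzc1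
    rw [← hmapS] at htail
    simp only [coeff_map] at htail
    -- ### `F^ψ(1/x) = ψ(α)/x^m` ([Schoof2009, Prop. 12.2 (ii)])
    set F : ℂ := ∏ c, (1 + a c * zc) ^ ((r c : ℝ) : ℂ) with hFdef
    have hfac : ∀ c, 1 + a c * zc = ψ ((x : K) - ζ ^ (c : ZMod p).val) * zc := by
      intro c
      rw [ha_eq, map_sub, map_intCast]
      linear_combination -hxz
    have hFq : F ^ q = (ψ α * zc ^ m) ^ q := by
      have h1 : ∀ c, ((1 + a c * zc) ^ ((r c : ℝ) : ℂ)) ^ q = (1 + a c * zc) ^ n c := by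
        intro c
        have h2 : (q : ℂ) * ((n c : ℂ) / q) = n c := by
          rw [mul_div_assoc']
          exact mul_div_cancel_left₀ _ (Nat.cast_ne_zero.mpr hq.ne_zero)
        rw [← Complex.cpow_nat_mul, hcast, h2, Complex.cpow_natCast]
      calc F ^ q = ∏ c, (1 + a c * zc) ^ n c := by
            rw [hFdef, ← prod_pow]
            exact prod_congr rfl fun c _ => h1 c
        _ = ∏ c : (ZMod p)ˣ, (ψ ((x : K) - ζ ^ (c : ZMod p).val) ^ n c * zc ^ n c) := by
            refine prod_congr rfl fun c _ => ?_
            rw [hfac, mul_pow]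
        _ = ψ (∏ c : (ZMod p)ˣ, ((x : K) - ζ ^ (c : ZMod p).val) ^ n c) * zc ^ (m * q) := by
            rw [prod_mul_distrib, map_prod, ← hm, prod_pow_eq_pow_sum]
            simp_rw [map_pow]
        _ = (ψ α * zc ^ m) ^ q := by rw [hα, map_pow, mul_pow, ← pow_mul]
    -- `F` is real: pair `c` with `-c`
    have hconj_a : ∀ c, starRingEnd ℂ (a c) = a (-c) := by
      intro c
      rw [ha_eq, ha_eq, map_neg, ← embedding_comp_gal_neg_one hζ ψ, gal_apply_zeta_pow hζ,
        neg_one_mul]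
    have hconj_zc : starRingEnd ℂ zc = zc := by rw [hzcdef, map_inv₀, map_intCast]
    have harg : ∀ c, (1 + a c * zc).arg ≠ Real.pi := by
      intro c h1
      have h2 := (Complex.arg_eq_pi_iff.mp h1).1
      have h3 : |(a c * zc).re| ≤ ‖a c * zc‖ := Complex.abs_re_le_norm _
      have h4 : ‖a c * zc‖ < 1 := by
        rw [norm_mul]
        calc ‖a c‖ * ‖zc‖ ≤ 1 * ‖zc‖ := by gcongr; exact ha1 c (mem_univ c)
          _ < 1 := by rw [one_mul]; exact hzc1
      rw [Complex.add_re, Complex.one_re] at h2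
      have := neg_abs_le (a c * zc).re
      linarith
    have hFreal : starRingEnd ℂ F = F := by
      rw [hFdef, map_prod]
      have h1 : ∀ c, starRingEnd ℂ ((1 + a c * zc) ^ ((r c : ℝ) : ℂ)) =
          (1 + a (-c) * zc) ^ ((r c : ℝ) : ℂ) := by
        intro c
        have h2 := Complex.conj_cpow (1 + a c * zc) ((r c : ℝ) : ℂ) (harg c)
        rw [Complex.conj_ofReal] at h2
        rw [← h2, map_add, map_one, map_mul, hconj_a, hconj_zc]
      simp_rw [h1]
      refine Fintype.prod_equiv (Equiv.neg _) _ _ fun c => ?_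
      simp only [Equiv.neg_apply, hrdef, hn]
    have hαreal := conj_embedding_eq_self hζ hpo hq hq2 hpq n hn hα ψ
    have hFeq : F = ψ α * zc ^ m := by
      have hF_re : F = (F.re : ℂ) := (Complex.conj_eq_iff_re.mp hFreal).symm
      have hα_re : ψ α = ((ψ α).re : ℂ) := (Complex.conj_eq_iff_re.mp hαreal).symm
      have hzc_re : zc = (((x : ℝ)⁻¹ : ℝ) : ℂ) := by
        rw [hzcdef, Complex.ofReal_inv, Complex.ofReal_intCast]
      have key : ((F.re ^ q : ℝ) : ℂ) = ((((ψ α).re * (x : ℝ)⁻¹ ^ m) ^ q : ℝ) : ℂ) := by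
        push_cast
        rw [← hF_re, ← hα_re, ← Complex.ofReal_intCast, ← Complex.ofReal_inv, ← hzc_re, hFq]
      have key' : F.re ^ q = ((ψ α).re * (x : ℝ)⁻¹ ^ m) ^ q := by exact_mod_cast key
      have key'' := (hqo.strictMono_pow (R := ℝ)).injective key'
      rw [hF_re, key'', hzc_re]
      conv_rhs => rw [hα_re]
      push_cast
      ring
    -- ### `ψ(W) = D x^m (F - F_m)` and the norm bound
    have hψW : ψ W = (q : ℂ) ^ (m + v) *
        ((x : ℂ) ^ m * (F - ∑ k ∈ range (m + 1), ψ (coeff k S) * zc ^ k)) := by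
      rw [show ψ W = ψ (algebraMap (𝓞 K) K W) from rfl, hWK, map_mul, map_pow, map_natCast,
        map_sub, map_sum]
      congr 1
      rw [mul_sub, mul_sum, hFeq]
      congr 1
      · calc ψ α = ψ α * ((x : ℂ) * zc) ^ m := by rw [hxz, one_pow, mul_one]
          _ = (x : ℂ) ^ m * (ψ α * zc ^ m) := by ring
      · refine sum_congr rfl fun k hk => ?_
        have hkm : k ≤ m := Nat.lt_succ_iff.mp (mem_range.mp hk)
        rw [map_mul, map_pow, map_intCast]
        have h1 : (x : ℂ) ^ m = (x : ℂ) ^ (m - k) * (x : ℂ) ^ k := by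
          rw [← pow_add, Nat.sub_add_cancel hkm]
        rw [h1]
        calc ψ (coeff k S) * (x : ℂ) ^ (m - k)
            = ψ (coeff k S) * (x : ℂ) ^ (m - k) * ((x : ℂ) * zc) ^ k := by
              rw [hxz, one_pow, mul_one]
          _ = (x : ℂ) ^ (m - k) * (x : ℂ) ^ k * (ψ (coeff k S) * zc ^ k) := by ring
    rw [hψW, norm_mul, norm_mul, norm_pow, norm_pow, Complex.norm_natCast, Complex.norm_intCast]
    calc (q : ℝ) ^ (m + v) * (|(x : ℝ)| ^ m * ‖F - ∑ k ∈ range (m + 1), ψ (coeff k S) * zc ^ k‖)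
        ≤ (q : ℝ) ^ (m + v) * (|(x : ℝ)| ^ m * (((2 * m).choose (m + 1) : ℝ) * ‖zc‖ ^ (m + 1) /
            (1 - ‖zc‖) ^ (2 * m + 1))) := by gcongr
      _ = B := by
          have h1 : Xr - 1 ≠ 0 := hXr1.ne'
          have h2 : Xr ≠ 0 := hXr0.ne'
          rw [hzc_norm, hBdef, ← hXrdef, inv_pow, show (1 - Xr⁻¹) = (Xr - 1) / Xr by field_simp,
            div_pow]
          field_simp
          ring
  have hW0 : W = 0 := eq_zero_of_forall_norm_embedding_le hB0 hB1 hbound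
  -- ### reading `D α = ∑_k D e_k x^{m-k}` modulo `q`: `q ∣ y_m`
  have hqy : (q : 𝓞 K) ∣ yk m := by
    have h1 : (q : 𝓞 K) ^ (m + v) * αO = ∑ k ∈ range (m + 1),
        (q : 𝓞 K) ^ ((m - k) + (v - padicValNat q (Nat.factorial k))) * yk k *
          (x : 𝓞 K) ^ (m - k) := sub_eq_zero.mp hW0
    rw [sum_range_succ, Nat.sub_self, Nat.sub_self, add_zero, pow_zero, pow_zero, one_mul,
      mul_one] at h1
    have h2 : (q : 𝓞 K) ∣ ∑ k ∈ range m,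
        (q : 𝓞 K) ^ ((m - k) + (v - padicValNat q (Nat.factorial k))) * yk k *
          (x : 𝓞 K) ^ (m - k) := by
      refine dvd_sum fun k hk => ?_
      have hkm : k < m := mem_range.mp hk
      exact dvd_mul_of_dvd_left (dvd_mul_of_dvd_left (dvd_pow_self _ (by omega)) _) _
    have h3 : (q : 𝓞 K) ∣ (q : 𝓞 K) ^ (m + v) * αO :=
      dvd_mul_of_dvd_left (dvd_pow_self _ (by omega)) _
    have h4 := dvd_sub h3 h2
    rwa [h1, add_sub_cancel_left] at h4
  -- `m! y_m = q^v c_m`, `m! = q^v M'`, hence `q ∣ c_m`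
  have hyc : (Nat.factorial m : 𝓞 K) * yk m = (q : 𝓞 K) ^ v * ck m := by
    apply FaithfulSMul.algebraMap_injective (𝓞 K) K
    rw [map_mul, map_mul, map_pow, map_natCast, map_natCast, hyk m, hck m]
    ring
  obtain ⟨M', hM'⟩ : q ^ v ∣ Nat.factorial m := pow_padicValNat_dvd
  have hqc : (q : 𝓞 K) ∣ ck m := by
    have h1 : (M' : 𝓞 K) * yk m = ck m := by
      apply mul_left_cancel₀ (pow_ne_zero v (Nat.cast_ne_zero.mpr hq.ne_zero : (q : 𝓞 K) ≠ 0))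
      rw [← hyc, hM']
      push_cast
      ring
    rw [← h1]
    exact dvd_mul_of_dvd_right hqy _
  -- `q ∣ (∑ n_c w_c)^m = (-∑ n_c ζ^c)^m`
  have hqs : (q : 𝓞 K) ∣ (∑ c, (n c : 𝓞 K) * z ^ (c : ZMod p).val) ^ m := by
    have h1 := dvd_sub hqc (hckq m)
    rw [sub_sub_cancel] at h1
    have h2 : ∑ c ∈ (univ : Finset (ZMod p)ˣ), (n c : 𝓞 K) * w c =
        -∑ c, (n c : 𝓞 K) * z ^ (c : ZMod p).val := by
      rw [← sum_neg_distrib]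
      exact sum_congr rfl fun c _ => by simp only [hwdef]; ring
    rw [h2, neg_pow] at h1
    exact ((isUnit_one.neg.pow m).dvd_mul_left).mp h1
  -- `ℤ[ζ_p]/(q)` is reduced [Schoof2009, Exercise 10.2]: `q ∣ ∑ n_c ζ^c`
  have hqs1 : (q : 𝓞 K) ∣ ∑ c, (n c : 𝓞 K) * z ^ (c : ZMod p).val := by
    haveI := isReduced_quotient_span_prime (K := K) hq hpq
    rw [← Ideal.mem_span_singleton, ← Ideal.Quotient.eq_zero_iff_mem]
    apply IsReduced.eq_zero _ ⟨m, ?_⟩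
    rw [← map_pow, Ideal.Quotient.eq_zero_iff_mem, Ideal.mem_span_singleton]
    exact hqs
  -- ### integral basis: `q ∣ n_c`
  have h1 := dvd_of_dvd_sum hζ (fun c => (n c : ℤ)) (q := q) (by simpa only [Int.cast_natCast]
    using hqs1) c₀
  exact Int.natCast_dvd_natCast.mp h1

end Cyclotomic

end Catalan.Plus

end Literature.NumberTheory.DiophantineGeometry
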